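import Summits.SmoothPoincare4.SmoothPoincare4.Theses.EntropyRung
import Summits.SmoothPoincare4.SmoothPoincare4.Theorems.EntropyRungSubcylindricalExistenceEntropyLocalisation
import Literature.Geometry.Lorentzian.GreenIdentity
import Literature.Geometry.Lorentzian.DalembertianCompose
import Literature.Geometry.Lorentzian.MassCapacityHarmonic
import Literature.Geometry.Lorentzian.CurvatureSymmetries
import Literature.Geometry.Riemannian.BakryEmeryHeatFlow
import Literature.Geometry.Riemannian.PerelmanEntropyCutoff
import HarnessLib

/-!
# Hardy inequality of the Green blow-up (stub `hardy_blowup`, line `green-blowup-conformal-entropy`,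
# crux `EntropyRung.SubcylindricalExistence`, item stmt-SmoothPoincare4-10871)

Helper H7 for Stub D of the line. Let `(p, G)` be Green data of the conformal Laplacian
`L_g = R − 6Δ` on a closed Riemannian `4`-manifold `(M, g)` of the summit binder (`G` smooth and
positive on `M ∖ {p}`, `R G − 6 ΔG = 0` there, `G → +∞` at `p`). For every smooth `v` vanishing
near `p`,

  `∫ (¼ |∇G|² + R G² / 12) v² dV_g ≤ ∫ G² |∇v|²_g dV_g`.

In terms of the blow-up `h = G² g` this is the Hardy inequality
`∫ (¼ |∇ log G|²_h + R_g / (12 G²)) v² dV_h ≤ ∫ |∇v|²_h dV_h`, which lets Stub D pay logarithmic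
cut-offs with Dirichlet energy.

Proof. (1) Pointwise, `0 ≤ |G dv + (v/2) dG|²_g = G² |dv|² + G v g⁻¹(dv, dG) + v² |dG|² / 4`
(the inverse metric of a Riemannian metric is positive semidefinite). (2) The cross term is
computed by Green's first identity on the closed manifold
(`integral_mul_dalembertian_eq_neg_integral_innerDual`, Lee 2018, Problem 2-23 (a)):
`4 ∫ G v g⁻¹(dv, dG) = ∫ g⁻¹(d(v²), d(G²)) = −∫ v² Δ(G²) = −∫ v² (2|∇G|² + R G² / 3)`
(`Δ(G²) = 2|∇G|² + 2 G ΔG`, `ΔG = R G / 6`). Since `G` is singular at `p`, Green's identity is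
applied to a globally smooth `Q` agreeing with `G` near `tsupport v`
(`exists_contMDiff_hasCompactSupport_eventuallyEq`); all integrands only see `Q` through points
where `v` does not vanish identically nearby (`HardyBlowup.hardy_of_contMDiff` is the smooth
statement, `hardy_blowup` the transfer). (3) Integrate (1) and insert (2).
References: J. M. Lee, *Introduction to Riemannian Manifolds* (2018), Problem 2-23 (a);
R. Schoen, J. Differential Geom. 20 (1984) (the blow-up `G² g`); J. M. Lee, T. H. Parker,
Bull. AMS 17 (1987), §6.
-/

noncomputable section

-- the registered namespace `Summit.SmoothPoincare4.SmoothPoincare4.Theorems` repeats a component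
set_option linter.dupNamespace false

open scoped Manifold ContDiff Topology ENNReal NNReal
open Set Filter MeasureTheory
open Literature.Geometry.Lorentzian Literature.Geometry.Riemannian

namespace Summit.SmoothPoincare4.SmoothPoincare4.Theorems

namespace HardyBlowup

variable {M : Type} [TopologicalSpace M] [ChartedSpace (EuclideanSpace ℝ (Fin 4)) M] [IsManifold (𝓡 4) ∞ M]
  (g : PseudoRiemannianMetric (𝓡 4) ∞ (EuclideanSpace ℝ (Fin 4)) (TangentSpace (𝓡 4) : M → Type _))

/-! ### Pointwise identities -/

/-- Expansion of the inverse metric on `a α + b β`: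
`g⁻¹(aα + bβ, aα + bβ) = a² g⁻¹(α, α) + 2ab g⁻¹(α, β) + b² g⁻¹(β, β)`. -/
theorem innerDual_smul_add_smul_self (x : M) (α β : Module.Dual ℝ (TangentSpace (𝓡 4) x)) (a b : ℝ) :
    g.innerDual x (a • α + b • β) (a • α + b • β) =
      a ^ 2 * g.innerDual x α α + 2 * a * b * g.innerDual x α β + b ^ 2 * g.innerDual x β β := by
  rw [g.innerDual_add_left, g.innerDual_smul_left, g.innerDual_smul_left,
    g.innerDual_comm x α (a • α + b • β), g.innerDual_comm x β (a • α + b • β),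
    g.innerDual_add_left, g.innerDual_add_left, g.innerDual_smul_left, g.innerDual_smul_left,
    g.innerDual_smul_left, g.innerDual_smul_left, g.innerDual_comm x β α]
  ring

/-- **The pointwise square completion** `0 ≤ |Q dv + (v/2) dQ|²_g`, in the form
`−Q v g⁻¹(dv, dQ) − v² |∇Q|² / 4 ≤ Q² |∇v|²`. -/
theorem pointwise_hardy (hg : g.IsRiemannian) (Q v : M → ℝ) (x : M) :
    -(Q x * v x * g.innerDual x (mvfderiv (𝓡 4) v x).toLinearMap (mvfderiv (𝓡 4) Q x).toLinearMap)
        - v x ^ 2 * g.gradSq Q x / 4 ≤ Q x ^ 2 * g.gradSq v x := by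
  have h0 := g.innerDual_self_nonneg hg x
    (Q x • (mvfderiv (𝓡 4) v x).toLinearMap + (v x / 2) • (mvfderiv (𝓡 4) Q x).toLinearMap)
  rw [innerDual_smul_add_smul_self] at h0
  unfold PseudoRiemannianMetric.gradSq
  linarith

omit [IsManifold (𝓡 4) ∞ M] in
/-- The differential of a square: `d(f²) = 2 f df` (as linear maps). -/
theorem dcov_sq {f : M → ℝ} {x : M} (hf : MDifferentiableAt (𝓡 4) 𝓘(ℝ, ℝ) f x) :
    (mvfderiv (𝓡 4) (fun y ↦ f y ^ 2) x).toLinearMap = (2 * f x) • (mvfderiv (𝓡 4) f x).toLinearMap := by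
  have h : (fun y ↦ f y ^ 2) = fun y ↦ f y * f y := funext fun y ↦ sq (f y)
  rw [h, EntropyLocalisation.dcov_mul hf hf, ← add_smul, ← two_mul]

/-- **The Laplace–Beltrami operator of a square**: `Δ(f²) = 2 |∇f|² + 2 f Δf` at a point where
`f` is `C²` (chain rule `dalembertian_real_comp` with `ζ(s) = s²`). -/
theorem dalembertian_sq [g.HasLeviCivita] {f : M → ℝ} {x : M} (hf : ContMDiffAt (𝓡 4) 𝓘(ℝ, ℝ) 2 f x) :
    g.dalembertian (fun y ↦ f y ^ 2) x = 2 * g.gradSq f x + 2 * f x * g.dalembertian f x := by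
  have hζ : ContDiffAt ℝ 2 (fun s : ℝ ↦ s ^ 2) (f x) := (contDiff_id.pow 2).contDiffAt
  have hd : deriv (fun s : ℝ ↦ s ^ 2) = fun s ↦ 2 * s := by
    funext s
    have h : HasDerivAt (fun s : ℝ ↦ s ^ 2) (2 * s) s := by simpa using hasDerivAt_pow 2 s
    exact h.deriv
  have hdd : deriv (deriv (fun s : ℝ ↦ s ^ 2)) = fun _ ↦ (2 : ℝ) := by
    rw [hd]
    funext s
    have h : HasDerivAt (fun s : ℝ ↦ 2 * s) 2 s := by simpa using (hasDerivAt_id s).const_mul (2 : ℝ)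
    exact h.deriv
  have key := g.dalembertian_real_comp hf hζ
  rw [hdd, hd] at key
  rw [show (fun y ↦ f y ^ 2) = (fun s : ℝ ↦ s ^ 2) ∘ f from rfl, key, PseudoRiemannianMetric.gradSq]

/-! ### The smooth Hardy inequality on the closed manifold -/

section Integral

variable [T2Space M] [CompactSpace M] [T3Space M] [MeasurableSpace M] [BorelSpace M] [g.HasLeviCivita]

/-- **Hardy inequality, smooth form.** For smooth `Q, v` on the closed Riemannian `4`-manifold with
`R Q − 6 ΔQ = 0` wherever `v ≠ 0`:
`∫ (¼|∇Q|² + R Q²/12) v² dV ≤ ∫ Q² |∇v|² dV`. Green's first identity (Lee 2018, Problem 2-23 (a))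
for `u = v²`, `f = Q²` computes the cross term of the pointwise square completion. -/
theorem hardy_of_contMDiff (hg : g.IsRiemannian) {Q v : M → ℝ} (hQ : ContMDiff (𝓡 4) 𝓘(ℝ, ℝ) ∞ Q)
    (hv : ContMDiff (𝓡 4) 𝓘(ℝ, ℝ) ∞ v)
    (hpde : ∀ x, v x ≠ 0 → g.scalarCurvature x * Q x - 6 * g.dalembertian Q x = 0) :
    ∫ x, (g.gradSq Q x / 4 + g.scalarCurvature x * Q x ^ 2 / 12) * v x ^ 2
        ∂(riemannianMeasure (g.toContMDiffRiemannianMetric hg)) ≤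
      ∫ x, Q x ^ 2 * g.gradSq v x ∂(riemannianMeasure (g.toContMDiffRiemannianMetric hg)) := by
  set μ : Measure M := riemannianMeasure (g.toContMDiffRiemannianMetric hg)
  have h1le : (1 : ℕ∞ω) ≤ ((⊤ : ℕ∞) : ℕ∞ω) := WithTop.coe_le_coe.mpr le_top
  have h2le : (2 : ℕ∞ω) ≤ ((⊤ : ℕ∞) : ℕ∞ω) := WithTop.coe_le_coe.mpr le_top
  have hvd : ∀ x, MDifferentiableAt (𝓡 4) 𝓘(ℝ, ℝ) v x := fun x ↦ (hv x).mdifferentiableAt (by simp)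
  have hQd : ∀ x, MDifferentiableAt (𝓡 4) 𝓘(ℝ, ℝ) Q x := fun x ↦ (hQ x).mdifferentiableAt (by simp)
  -- continuity of the ingredients and integrability on the closed manifold
  have hRc : Continuous g.scalarCurvature := g.contMDiff_scalarCurvature.continuous
  have hGv : Continuous (g.gradSq v) := (contMDiff_gradSq g hv).continuous
  have hGQ : Continuous (g.gradSq Q) := (contMDiff_gradSq g hQ).continuous
  have hBc : Continuous fun x ↦ g.innerDual x (mvfderiv (𝓡 4) v x).toLinearMap (mvfderiv (𝓡 4) Q x).toLinearMap :=
    continuous_innerDual_mvfderiv g (hv.of_le h1le) (hQ.of_le h1le)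
  have hvc : Continuous v := hv.continuous
  have hQc : Continuous Q := hQ.continuous
  have hint : ∀ {F : M → ℝ}, Continuous F → Integrable F μ := fun hF ↦
    EntropyLocalisation.integrable_of_continuous g hg hF
  -- Green's first identity for `u = v²`, `f = Q²`
  haveI : (PseudoRiemannianMetric.ofRiemannian (g.toContMDiffRiemannianMetric hg)).HasLeviCivita := ‹g.HasLeviCivita›
  have hu1 : ContMDiff (𝓡 4) 𝓘(ℝ, ℝ) 1 (fun y ↦ v y ^ 2) := (hv.pow 2).of_le h1le
  have hf2 : ContMDiff (𝓡 4) 𝓘(ℝ, ℝ) 2 (fun y ↦ Q y ^ 2) := (hQ.pow 2).of_le h2le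
  have hGreen : ∫ x, v x ^ 2 * g.dalembertian (fun y ↦ Q y ^ 2) x ∂μ =
      -∫ x, g.innerDual x (mvfderiv (𝓡 4) (fun y ↦ v y ^ 2) x).toLinearMap
        (mvfderiv (𝓡 4) (fun y ↦ Q y ^ 2) x).toLinearMap ∂μ :=
    integral_mul_dalembertian_eq_neg_integral_innerDual (g.toContMDiffRiemannianMetric hg) hu1 hf2
  -- the two integrands of Green's identity, pointwise
  have hL : ∀ x, v x ^ 2 * g.dalembertian (fun y ↦ Q y ^ 2) x =
      4 * (v x ^ 2 * (g.gradSq Q x / 2 + g.scalarCurvature x * Q x ^ 2 / 12)) := by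
    intro x
    by_cases hvx : v x = 0
    · simp [hvx]
    · rw [dalembertian_sq g ((hQ x).of_le h2le)]
      linear_combination (-(v x ^ 2 * Q x / 3)) * hpde x hvx
  have hR : ∀ x, g.innerDual x (mvfderiv (𝓡 4) (fun y ↦ v y ^ 2) x).toLinearMap (mvfderiv (𝓡 4) (fun y ↦ Q y ^ 2) x).toLinearMap =
      4 * (Q x * v x * g.innerDual x (mvfderiv (𝓡 4) v x).toLinearMap (mvfderiv (𝓡 4) Q x).toLinearMap) := by
    intro x
    rw [dcov_sq (hvd x), dcov_sq (hQd x), g.innerDual_smul_left, g.innerDual_smul_right]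
    ring
  have hcross : ∫ x, v x ^ 2 * (g.gradSq Q x / 2 + g.scalarCurvature x * Q x ^ 2 / 12) ∂μ =
      -∫ x, Q x * v x * g.innerDual x (mvfderiv (𝓡 4) v x).toLinearMap (mvfderiv (𝓡 4) Q x).toLinearMap ∂μ := by
    have e1 : ∫ x, v x ^ 2 * g.dalembertian (fun y ↦ Q y ^ 2) x ∂μ =
        4 * ∫ x, v x ^ 2 * (g.gradSq Q x / 2 + g.scalarCurvature x * Q x ^ 2 / 12) ∂μ := by
      rw [← integral_const_mul]
      exact integral_congr_ae (ae_of_all _ hL)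
    have e2 : ∫ x, g.innerDual x (mvfderiv (𝓡 4) (fun y ↦ v y ^ 2) x).toLinearMap
          (mvfderiv (𝓡 4) (fun y ↦ Q y ^ 2) x).toLinearMap ∂μ =
        4 * ∫ x, Q x * v x * g.innerDual x (mvfderiv (𝓡 4) v x).toLinearMap (mvfderiv (𝓡 4) Q x).toLinearMap ∂μ := by
      rw [← integral_const_mul]
      exact integral_congr_ae (ae_of_all _ hR)
    rw [e1, e2] at hGreen
    linarith
  -- split the left integrand: a part of integral zero plus a part dominated pointwise
  have hI1 : Integrable (fun x ↦ v x ^ 2 * (g.gradSq Q x / 2 + g.scalarCurvature x * Q x ^ 2 / 12)) μ :=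
    hint ((hvc.pow 2).mul ((hGQ.div_const 2).add (((hRc.mul (hQc.pow 2)).div_const 12))))
  have hI2 : Integrable (fun x ↦ Q x * v x *
      g.innerDual x (mvfderiv (𝓡 4) v x).toLinearMap (mvfderiv (𝓡 4) Q x).toLinearMap) μ :=
    hint ((hQc.mul hvc).mul hBc)
  have hI3 : Integrable (fun x ↦ v x ^ 2 * g.gradSq Q x / 4) μ := hint (((hvc.pow 2).mul hGQ).div_const 4)
  have hI4 : Integrable (fun x ↦ Q x ^ 2 * g.gradSq v x) μ := hint ((hQc.pow 2).mul hGv)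
  have hI12 : Integrable (fun x ↦ v x ^ 2 * (g.gradSq Q x / 2 + g.scalarCurvature x * Q x ^ 2 / 12)
      + Q x * v x * g.innerDual x (mvfderiv (𝓡 4) v x).toLinearMap (mvfderiv (𝓡 4) Q x).toLinearMap) μ := hI1.add hI2
  have hI23 : Integrable (fun x ↦ -(Q x * v x * g.innerDual x (mvfderiv (𝓡 4) v x).toLinearMap (mvfderiv (𝓡 4) Q x).toLinearMap)
      - v x ^ 2 * g.gradSq Q x / 4) μ := hI2.neg.sub hI3
  have hsplit : ∀ x, (g.gradSq Q x / 4 + g.scalarCurvature x * Q x ^ 2 / 12) * v x ^ 2 =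
      (v x ^ 2 * (g.gradSq Q x / 2 + g.scalarCurvature x * Q x ^ 2 / 12)
        + Q x * v x * g.innerDual x (mvfderiv (𝓡 4) v x).toLinearMap (mvfderiv (𝓡 4) Q x).toLinearMap)
      + (-(Q x * v x * g.innerDual x (mvfderiv (𝓡 4) v x).toLinearMap (mvfderiv (𝓡 4) Q x).toLinearMap)
        - v x ^ 2 * g.gradSq Q x / 4) := fun x ↦ by ring
  calc ∫ x, (g.gradSq Q x / 4 + g.scalarCurvature x * Q x ^ 2 / 12) * v x ^ 2 ∂μ
      = ∫ x, ((v x ^ 2 * (g.gradSq Q x / 2 + g.scalarCurvature x * Q x ^ 2 / 12)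
          + Q x * v x * g.innerDual x (mvfderiv (𝓡 4) v x).toLinearMap (mvfderiv (𝓡 4) Q x).toLinearMap)
        + (-(Q x * v x * g.innerDual x (mvfderiv (𝓡 4) v x).toLinearMap (mvfderiv (𝓡 4) Q x).toLinearMap)
          - v x ^ 2 * g.gradSq Q x / 4)) ∂μ := integral_congr_ae (ae_of_all _ hsplit)
    _ = (∫ x, (v x ^ 2 * (g.gradSq Q x / 2 + g.scalarCurvature x * Q x ^ 2 / 12)
          + Q x * v x * g.innerDual x (mvfderiv (𝓡 4) v x).toLinearMap (mvfderiv (𝓡 4) Q x).toLinearMap) ∂μ)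
        + ∫ x, (-(Q x * v x * g.innerDual x (mvfderiv (𝓡 4) v x).toLinearMap (mvfderiv (𝓡 4) Q x).toLinearMap)
          - v x ^ 2 * g.gradSq Q x / 4) ∂μ := integral_add hI12 hI23
    _ = ∫ x, (-(Q x * v x * g.innerDual x (mvfderiv (𝓡 4) v x).toLinearMap (mvfderiv (𝓡 4) Q x).toLinearMap)
          - v x ^ 2 * g.gradSq Q x / 4) ∂μ := by rw [integral_add hI1 hI2, hcross, neg_add_cancel, zero_add]
    _ ≤ ∫ x, Q x ^ 2 * g.gradSq v x ∂μ := integral_mono hI23 hI4 fun x ↦ pointwise_hardy g hg Q v x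

end Integral

end HardyBlowup

/-- **Helper H7 (registered stub `hardy_blowup`) — Hardy inequality of the Green blow-up.**
For Green data `(p, G)` of `L_g = R − 6Δ` on a closed Riemannian `4`-manifold of the summit binder
and every smooth `v` vanishing near `p`:
`∫ (¼|∇G|² + R G²/12) v² dV_g ≤ ∫ G² |∇v|²_g dV_g`. Transfer of `HardyBlowup.hardy_of_contMDiff`
along a smooth globalisation `Q` of `G` near `tsupport v` (`exists_contMDiff_hasCompactSupport_eventuallyEq`;
locality of `Δ`, of the differential and of `|∇·|²`). Lee 2018, Problem 2-23 (a); Schoen 1984;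
Lee–Parker 1987, §6. -/
theorem hardy_blowup :
    ∀ (M : Type) [TopologicalSpace M] [T2Space M] [SecondCountableTopology M]
      [ChartedSpace (EuclideanSpace ℝ (Fin 4)) M] [IsManifold (𝓡 4) ∞ M] [CompactSpace M]
      [T3Space M] [MeasurableSpace M] [BorelSpace M]
      (g : PseudoRiemannianMetric (𝓡 4) ∞ (EuclideanSpace ℝ (Fin 4)) (TangentSpace (𝓡 4) : M → Type _))
      [g.HasLeviCivita] (hg : g.IsRiemannian) (p : M) (G : M → ℝ),
        (ContMDiffOn (𝓡 4) 𝓘(ℝ, ℝ) ∞ G {p}ᶜ ∧ (∀ x, x ≠ p → 0 < G x) ∧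
          (∀ x, x ≠ p → g.scalarCurvature x * G x - 6 * g.dalembertian G x = 0) ∧
          Tendsto G (𝓝[≠] p) atTop) →
      ∀ v : M → ℝ, ContMDiff (𝓡 4) 𝓘(ℝ, ℝ) ∞ v → v =ᶠ[𝓝 p] 0 →
        ∫ x, (g.gradSq G x / 4 + g.scalarCurvature x * G x ^ 2 / 12) * v x ^ 2
            ∂(riemannianMeasure (g.toContMDiffRiemannianMetric hg)) ≤
          ∫ x, G x ^ 2 * g.gradSq v x ∂(riemannianMeasure (g.toContMDiffRiemannianMetric hg)) := by
  intro M _ _ _ _ _ _ _ _ _ g _ hg p G hGreen v hv hvp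
  obtain ⟨hGs, -, hGpde, -⟩ := hGreen
  -- `tsupport v` is a compact subset of the open set `{p}ᶜ`, on which `G` is smooth
  have hpv : p ∉ tsupport v := notMem_tsupport_iff_eventuallyEq.2 hvp
  have hK : IsCompact (tsupport v) := (isClosed_tsupport v).isCompact
  have hKU : tsupport v ⊆ {p}ᶜ := fun x hx hxp ↦ hpv (mem_singleton_iff.1 hxp ▸ hx)
  -- globalise `G` near `tsupport v`
  obtain ⟨Q, hQ, -, -, V, -, hKV, hVU, hV⟩ :=
    exists_contMDiff_hasCompactSupport_eventuallyEq (I := 𝓡 4) isOpen_compl_singleton hK hKU hGs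
  have hout : ∀ x ∉ V, v =ᶠ[𝓝 x] 0 := fun x hx ↦ notMem_tsupport_iff_eventuallyEq.1 fun h ↦ hx (hKV h)
  -- the equation for `Q` wherever `v ≠ 0`
  have hpde : ∀ x, v x ≠ 0 → g.scalarCurvature x * Q x - 6 * g.dalembertian Q x = 0 := by
    intro x hx
    have hxV : x ∈ V := hKV (subset_tsupport v hx)
    have hxp : x ≠ p := mem_compl_singleton_iff.1 (hVU hxV)
    rw [(hV x hxV).eq_of_nhds, g.dalembertian_congr_of_eventuallyEq (hV x hxV)]
    exact hGpde x hxp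
  have key := HardyBlowup.hardy_of_contMDiff g hg hQ hv hpde
  -- both integrands only see `G` near `tsupport v`
  have e1 : ∀ x, (g.gradSq G x / 4 + g.scalarCurvature x * G x ^ 2 / 12) * v x ^ 2 =
      (g.gradSq Q x / 4 + g.scalarCurvature x * Q x ^ 2 / 12) * v x ^ 2 := by
    intro x
    by_cases hxV : x ∈ V
    · rw [(hV x hxV).eq_of_nhds]
      simp only [PseudoRiemannianMetric.gradSq, mvfderiv_congr_of_eventuallyEq (hV x hxV)]
    · rw [(hout x hxV).eq_of_nhds]
      simp
  have e2 : ∀ x, G x ^ 2 * g.gradSq v x = Q x ^ 2 * g.gradSq v x := by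
    intro x
    by_cases hxV : x ∈ V
    · rw [(hV x hxV).eq_of_nhds]
    · have h0 : g.gradSq v x = 0 :=
        g.gradSq_eq_zero_of_mvfderiv_eq_zero (by rw [mvfderiv_congr_of_eventuallyEq (hout x hxV), mvfderiv_zero])
      rw [h0]
      simp
  have i1 : ∫ x, (g.gradSq G x / 4 + g.scalarCurvature x * G x ^ 2 / 12) * v x ^ 2
        ∂(riemannianMeasure (g.toContMDiffRiemannianMetric hg)) =
      ∫ x, (g.gradSq Q x / 4 + g.scalarCurvature x * Q x ^ 2 / 12) * v x ^ 2
        ∂(riemannianMeasure (g.toContMDiffRiemannianMetric hg)) := integral_congr_ae (ae_of_all _ e1)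
  have i2 : ∫ x, G x ^ 2 * g.gradSq v x ∂(riemannianMeasure (g.toContMDiffRiemannianMetric hg)) =
      ∫ x, Q x ^ 2 * g.gradSq v x ∂(riemannianMeasure (g.toContMDiffRiemannianMetric hg)) := integral_congr_ae (ae_of_all _ e2)
  rw [i1, i2]
  exact key

end Summit.SmoothPoincare4.SmoothPoincare4.Theorems

end
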